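import Literature.NumberTheory.LFunctions.WeilTwoPrimeCellsT80Data1
import HarnessLib

/-!
# Two-prime minorant cells on `[0, 80]`: kernel check of cells 84–190

`TPDCell.checkZ 120 5` on cells 84–190 of `weilTwoPrimeCellsT80` (the chunk `weilTwoPrimeCellsT80C1`), by
`decide +kernel` in two halves (one kernel evaluation of the whole chunk exceeds the reduction budget of a single
declaration), assembled with `List.take_append_drop`. Pure proof file; nothing is asserted.
-/

noncomputable section

namespace Literature.NumberTheory.LFunctions

set_option maxHeartbeats 0 in
/-- Kernel check of the first 53 cells of the chunk. [folklore] -/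
theorem checkCells_weilTwoPrimeCellsT80C1_take :
    ((weilTwoPrimeCellsT80C1.take 53).all fun c ↦ c.checkZ 120 5) = true := by
  decide +kernel

set_option maxHeartbeats 0 in
/-- Kernel check of the remaining cells of the chunk. [folklore] -/
theorem checkCells_weilTwoPrimeCellsT80C1_drop :
    ((weilTwoPrimeCellsT80C1.drop 53).all fun c ↦ c.checkZ 120 5) = true := by
  decide +kernel

/-- **Kernel check of cells 84–190** of the two-prime minorant on `[0, 80]` (assembled from the halves). [folklore] -/
theorem checkCells_weilTwoPrimeCellsT80C1 :
    (weilTwoPrimeCellsT80C1.all fun c ↦ c.checkZ 120 5) = true := by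
  rw [← List.take_append_drop 53 weilTwoPrimeCellsT80C1, List.all_append,
    checkCells_weilTwoPrimeCellsT80C1_take, checkCells_weilTwoPrimeCellsT80C1_drop, Bool.and_self]

end Literature.NumberTheory.LFunctions
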